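import Mathlib
import HarnessLib
import Summits.HubbardSuperconductivity.HubbardSuperconductivity.Theorems.KLProgrammeKLRegimeSectorMultiplierPairWtRates

/-!
# Route `KLProgramme` — engine support, route (L2): real bookkeeping for the WEIGHTED α rows instance — packaging of the isotropic ORDER-THREE
# constant of the FAT pair `F̃_ω F̃_ω′` as `κ₃ᶠ·W³/Λ³`, and monotonicity of the order-three Leibniz left-hand side of `slicePairWt_charSum_l1_le`

Cell `gate-hubbard-kl`, seat p3 (g10); program «W3α = α_w rows instance» (KL STATUS 2026-08-27 20:43Z), rates supplement.

* **`iso3_pack_fat_le`** — in the shape produced by `norm_fwdDiff_three_space_fatPair_le` (`τ = G₁Wn`, `K₃ = 4+8A₃`, angular sizes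
  `cd·12B·X`, `cd·(12B+72B²)X²`, `cd·(12B+216B²)X³`, `X = Dn·Wm`): if `0 ≤ Wn ≤ W`, `0 ≤ Wm ≤ 2W`, `0 ≤ Dn ≤ 3N`, `0 ≤ cd ≤ cdb`, `Λ ≤ E′`,
  `ΛN ≤ E`, `A₃Λ² ≤ a₃` then the constant is `≤ κ₃ᶠ·W³/Λ³`,
  `κ₃ᶠ = (8g₃+12g₂)G₁³ + (12g₂+6g₁)G₁K₂E′ + 2g₁(4E′²+8a₃) + 216·cdb·B((4g₂+2g₁)G₁²E + 2g₁K₂E′E) + 216·cdb·g₁G₁(12B+72B²)E² + 216·cdb·(12B+216B²)E³`;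
* **`slicePair_lhs3_mono`** — the order-three space left-hand side of `slicePairWt_charSum_l1_le` is monotone in the data `a₁, a₂, a₃`, the step
  norm `ne` and the tangency datum `t`.

Pure real algebra. [folklore]
-/

noncomputable section

namespace Summit.HubbardSuperconductivity.HubbardSuperconductivity.Theorems.TorusFourierL2

set_option linter.dupNamespace false -- summit = problem name (single-conjunct summit), D-0017

open scoped Real

set_option maxHeartbeats 800000 in -- long explicit real bookkeeping
/-- **The isotropic order-three constant of the fat pair packaged as `κ₃ᶠ·W³/Λ³`** (see the module docstring). [folklore] -/
theorem iso3_pack_fat_le {g₁ g₂ g₃ G₁ K₂ A₃ a₃ B cd cdb Λ N E E' W Wn Wm Dn : ℝ} (hg₁ : 0 ≤ g₁) (hg₂ : 0 ≤ g₂) (hg₃ : 0 ≤ g₃)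
    (hG₁ : 0 ≤ G₁) (hK₂ : 0 ≤ K₂) (hA₃ : 0 ≤ A₃) (hB : 0 ≤ B) (hcd0 : 0 ≤ cd) (hcd : cd ≤ cdb) (hΛ : 0 < Λ) (hN : 0 ≤ N) (hW : 0 ≤ W)
    (hWn0 : 0 ≤ Wn) (hWn : Wn ≤ W) (hWm0 : 0 ≤ Wm) (hWm : Wm ≤ 2 * W) (hDn0 : 0 ≤ Dn) (hDn : Dn ≤ 3 * N) (hΛe : Λ ≤ E')
    (hΛN : Λ * N ≤ E) (ha₃ : A₃ * Λ ^ 2 ≤ a₃) :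
    ((8 * g₃ + 12 * g₂) * (G₁ * Wn) ^ 3 / Λ ^ 3 + (12 * g₂ + 6 * g₁) * ((G₁ * Wn) * (K₂ * Wn ^ 2)) / Λ ^ 2 +
          2 * g₁ * ((4 + 8 * A₃) * Wn ^ 3) / Λ) * 1 +
        3 * (((4 * g₂ + 2 * g₁) * (G₁ * Wn) ^ 2 / Λ ^ 2 + 2 * g₁ * (K₂ * Wn ^ 2) / Λ) * (cd * (12 * B * (Dn * Wm)))) +
        3 * (2 * g₁ * (G₁ * Wn) / Λ * (cd * ((12 * B + 72 * B ^ 2) * (Dn * Wm) ^ 2))) +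
        1 * (cd * ((12 * B + 216 * B ^ 2) * (Dn * Wm) ^ 3)) ≤
      ((8 * g₃ + 12 * g₂) * G₁ ^ 3 + (12 * g₂ + 6 * g₁) * G₁ * K₂ * E' + 2 * g₁ * (4 * E' ^ 2 + 8 * a₃) +
          216 * cdb * B * ((4 * g₂ + 2 * g₁) * G₁ ^ 2 * E + 2 * g₁ * K₂ * E' * E) + 216 * cdb * g₁ * G₁ * (12 * B + 72 * B ^ 2) * E ^ 2 +
          216 * cdb * (12 * B + 216 * B ^ 2) * E ^ 3) * W ^ 3 / Λ ^ 3 := by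
  have he' : 0 ≤ E' := hΛ.le.trans hΛe
  have hE : 0 ≤ E := le_trans (by positivity) hΛN
  have hcdb : 0 ≤ cdb := hcd0.trans hcd
  have hW3 : Wn ^ 3 ≤ W ^ 3 := pow_le_pow_left₀ hWn0 hWn 3
  have hW2 : Wn ^ 2 ≤ W ^ 2 := pow_le_pow_left₀ hWn0 hWn 2
  set X : ℝ := Dn * Wm with hXdef
  have hX0 : 0 ≤ X := mul_nonneg hDn0 hWm0
  have hX : X ≤ 3 * N * (2 * W) := mul_le_mul hDn hWm hWm0 (by positivity)
  have hΛ3 : 0 < Λ ^ 3 := pow_pos hΛ 3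
  have hB12 : 0 ≤ 12 * B := by positivity
  have hB72 : 0 ≤ 12 * B + 72 * B ^ 2 := by positivity
  have hB216 : 0 ≤ 12 * B + 216 * B ^ 2 := by positivity
  -- term 1
  have t1 : (8 * g₃ + 12 * g₂) * (G₁ * Wn) ^ 3 / Λ ^ 3 ≤ (8 * g₃ + 12 * g₂) * G₁ ^ 3 * (W ^ 3 / Λ ^ 3) := by
    rw [mul_pow, mul_div_assoc, mul_assoc, mul_div_assoc]
    refine mul_le_mul_of_nonneg_left ?_ (by positivity)
    exact mul_le_mul_of_nonneg_left (div_le_div_of_nonneg_right hW3 hΛ3.le) (by positivity)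
  -- term 2
  have t2 : (12 * g₂ + 6 * g₁) * ((G₁ * Wn) * (K₂ * Wn ^ 2)) / Λ ^ 2 ≤ (12 * g₂ + 6 * g₁) * G₁ * K₂ * E' * (W ^ 3 / Λ ^ 3) := by
    have e : (12 * g₂ + 6 * g₁) * ((G₁ * Wn) * (K₂ * Wn ^ 2)) / Λ ^ 2 = (12 * g₂ + 6 * g₁) * G₁ * K₂ * Λ * (Wn ^ 3 / Λ ^ 3) := by
      field_simp
    rw [e]
    have h1 : (12 * g₂ + 6 * g₁) * G₁ * K₂ * Λ ≤ (12 * g₂ + 6 * g₁) * G₁ * K₂ * E' := mul_le_mul_of_nonneg_left hΛe (by positivity)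
    exact mul_le_mul h1 (div_le_div_of_nonneg_right hW3 hΛ3.le) (by positivity) (by positivity)
  -- term 3
  have t3 : 2 * g₁ * ((4 + 8 * A₃) * Wn ^ 3) / Λ ≤ 2 * g₁ * (4 * E' ^ 2 + 8 * a₃) * (W ^ 3 / Λ ^ 3) := by
    have e : 2 * g₁ * ((4 + 8 * A₃) * Wn ^ 3) / Λ = 2 * g₁ * (4 * Λ ^ 2 + 8 * (A₃ * Λ ^ 2)) * (Wn ^ 3 / Λ ^ 3) := by
      field_simp
    rw [e]
    have hΛ2 : Λ ^ 2 ≤ E' ^ 2 := pow_le_pow_left₀ hΛ.le hΛe 2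
    have h1 : 2 * g₁ * (4 * Λ ^ 2 + 8 * (A₃ * Λ ^ 2)) ≤ 2 * g₁ * (4 * E' ^ 2 + 8 * a₃) :=
      mul_le_mul_of_nonneg_left (by linarith) (by positivity)
    have h0 : 0 ≤ 2 * g₁ * (4 * E' ^ 2 + 8 * a₃) := le_trans (by positivity) h1
    exact mul_le_mul h1 (div_le_div_of_nonneg_right hW3 hΛ3.le) (by positivity) h0
  -- term 4
  have t4 : 3 * (((4 * g₂ + 2 * g₁) * (G₁ * Wn) ^ 2 / Λ ^ 2 + 2 * g₁ * (K₂ * Wn ^ 2) / Λ) * (cd * (12 * B * (Dn * Wm)))) ≤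
      216 * cdb * B * ((4 * g₂ + 2 * g₁) * G₁ ^ 2 * E + 2 * g₁ * K₂ * E' * E) * (W ^ 3 / Λ ^ 3) := by
    have hbr : (4 * g₂ + 2 * g₁) * (G₁ * Wn) ^ 2 / Λ ^ 2 + 2 * g₁ * (K₂ * Wn ^ 2) / Λ ≤
        ((4 * g₂ + 2 * g₁) * G₁ ^ 2 * Λ + 2 * g₁ * K₂ * Λ ^ 2) * (W ^ 2 / Λ ^ 3) := by
      have e : (4 * g₂ + 2 * g₁) * (G₁ * Wn) ^ 2 / Λ ^ 2 + 2 * g₁ * (K₂ * Wn ^ 2) / Λ =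
          ((4 * g₂ + 2 * g₁) * G₁ ^ 2 * Λ + 2 * g₁ * K₂ * Λ ^ 2) * (Wn ^ 2 / Λ ^ 3) := by field_simp
      rw [e]
      exact mul_le_mul_of_nonneg_left (div_le_div_of_nonneg_right hW2 hΛ3.le) (by positivity)
    have hbr0 : 0 ≤ (4 * g₂ + 2 * g₁) * (G₁ * Wn) ^ 2 / Λ ^ 2 + 2 * g₁ * (K₂ * Wn ^ 2) / Λ := by positivity
    have hz : cd * (12 * B * (Dn * Wm)) ≤ cdb * (12 * B * (3 * N * (2 * W))) := by
      rw [← hXdef]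
      exact mul_le_mul hcd (mul_le_mul_of_nonneg_left hX hB12) (by positivity) hcdb
    calc _ ≤ 3 * ((((4 * g₂ + 2 * g₁) * G₁ ^ 2 * Λ + 2 * g₁ * K₂ * Λ ^ 2) * (W ^ 2 / Λ ^ 3)) * (cdb * (12 * B * (3 * N * (2 * W))))) :=
          mul_le_mul_of_nonneg_left (mul_le_mul hbr hz (by rw [← hXdef]; positivity) (le_trans hbr0 hbr)) (by norm_num)
      _ = 216 * cdb * B * (((4 * g₂ + 2 * g₁) * G₁ ^ 2 * (Λ * N) + 2 * g₁ * K₂ * Λ * (Λ * N))) * (W ^ 3 / Λ ^ 3) := by ring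
      _ ≤ 216 * cdb * B * ((4 * g₂ + 2 * g₁) * G₁ ^ 2 * E + 2 * g₁ * K₂ * E' * E) * (W ^ 3 / Λ ^ 3) := by
          have hΛN0 : 0 ≤ Λ * N := by positivity
          gcongr
  -- term 5
  have t5 : 3 * (2 * g₁ * (G₁ * Wn) / Λ * (cd * ((12 * B + 72 * B ^ 2) * (Dn * Wm) ^ 2))) ≤
      216 * cdb * g₁ * G₁ * (12 * B + 72 * B ^ 2) * E ^ 2 * (W ^ 3 / Λ ^ 3) := by
    have hz : cd * ((12 * B + 72 * B ^ 2) * (Dn * Wm) ^ 2) ≤ cdb * ((12 * B + 72 * B ^ 2) * (3 * N * (2 * W)) ^ 2) := by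
      rw [← hXdef]
      exact mul_le_mul hcd (mul_le_mul_of_nonneg_left (pow_le_pow_left₀ hX0 hX 2) hB72) (by positivity) hcdb
    calc _ ≤ 3 * (2 * g₁ * (G₁ * W) / Λ * (cdb * ((12 * B + 72 * B ^ 2) * (3 * N * (2 * W)) ^ 2))) := by
          refine mul_le_mul_of_nonneg_left (mul_le_mul ?_ hz (by rw [← hXdef]; positivity) (by positivity)) (by norm_num)
          gcongr
      _ = 216 * cdb * g₁ * G₁ * (12 * B + 72 * B ^ 2) * (Λ * N) ^ 2 * (W ^ 3 / Λ ^ 3) := by field_simp; ring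
      _ ≤ 216 * cdb * g₁ * G₁ * (12 * B + 72 * B ^ 2) * E ^ 2 * (W ^ 3 / Λ ^ 3) := by
          have : (Λ * N) ^ 2 ≤ E ^ 2 := pow_le_pow_left₀ (by positivity) hΛN 2
          gcongr
  -- term 6
  have t6 : 1 * (cd * ((12 * B + 216 * B ^ 2) * (Dn * Wm) ^ 3)) ≤ 216 * cdb * (12 * B + 216 * B ^ 2) * E ^ 3 * (W ^ 3 / Λ ^ 3) := by
    have hz : cd * ((12 * B + 216 * B ^ 2) * (Dn * Wm) ^ 3) ≤ cdb * ((12 * B + 216 * B ^ 2) * (3 * N * (2 * W)) ^ 3) := by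
      rw [← hXdef]
      exact mul_le_mul hcd (mul_le_mul_of_nonneg_left (pow_le_pow_left₀ hX0 hX 3) hB216) (by positivity) hcdb
    calc _ ≤ 1 * (cdb * ((12 * B + 216 * B ^ 2) * (3 * N * (2 * W)) ^ 3)) := by rw [one_mul, one_mul]; exact hz
      _ = 216 * cdb * (12 * B + 216 * B ^ 2) * (Λ * N) ^ 3 * (W ^ 3 / Λ ^ 3) := by field_simp; ring
      _ ≤ 216 * cdb * (12 * B + 216 * B ^ 2) * E ^ 3 * (W ^ 3 / Λ ^ 3) := by
          have : (Λ * N) ^ 3 ≤ E ^ 3 := pow_le_pow_left₀ (by positivity) hΛN 3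
          gcongr
  have etot : ((8 * g₃ + 12 * g₂) * G₁ ^ 3 + (12 * g₂ + 6 * g₁) * G₁ * K₂ * E' + 2 * g₁ * (4 * E' ^ 2 + 8 * a₃) +
          216 * cdb * B * ((4 * g₂ + 2 * g₁) * G₁ ^ 2 * E + 2 * g₁ * K₂ * E' * E) + 216 * cdb * g₁ * G₁ * (12 * B + 72 * B ^ 2) * E ^ 2 +
          216 * cdb * (12 * B + 216 * B ^ 2) * E ^ 3) * W ^ 3 / Λ ^ 3 =
      (8 * g₃ + 12 * g₂) * G₁ ^ 3 * (W ^ 3 / Λ ^ 3) + (12 * g₂ + 6 * g₁) * G₁ * K₂ * E' * (W ^ 3 / Λ ^ 3) +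
        2 * g₁ * (4 * E' ^ 2 + 8 * a₃) * (W ^ 3 / Λ ^ 3) +
        216 * cdb * B * ((4 * g₂ + 2 * g₁) * G₁ ^ 2 * E + 2 * g₁ * K₂ * E' * E) * (W ^ 3 / Λ ^ 3) +
        216 * cdb * g₁ * G₁ * (12 * B + 72 * B ^ 2) * E ^ 2 * (W ^ 3 / Λ ^ 3) +
        216 * cdb * (12 * B + 216 * B ^ 2) * E ^ 3 * (W ^ 3 / Λ ^ 3) := by ring
  rw [etot, mul_one]
  linarith [t1, t2, t3, t4, t5, t6]

/-- **Monotonicity of the order-three Leibniz left-hand side of `slicePairWt_charSum_l1_le` (space directions)** in the multiplier data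
`a₁, a₂, a₃`, the Euclidean step norm `ne` and the tangency datum `t` (all coefficients nonnegative). [folklore] -/
theorem slicePair_lhs3_mono {c₀n C₃ C₂ C₁ c Λ K₂ K₃ s₅ s₄ a₁ a₁' a₂ a₂' a₃ a₃' ne ne' t t' : ℝ}
    (hc₀n : 0 ≤ c₀n) (hC₃ : 0 ≤ C₃) (hC₂ : 0 ≤ C₂) (hC₁ : 0 ≤ C₁) (hc : 0 ≤ c) (hΛ : 0 < Λ) (hK₂ : 0 ≤ K₂) (hK₃ : 0 ≤ K₃)
    (hs₅ : 0 ≤ s₅) (hs₄ : 0 ≤ s₄)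
    (ha₁0 : 0 ≤ a₁) (ha₁ : a₁ ≤ a₁') (ha₂0 : 0 ≤ a₂) (ha₂ : a₂ ≤ a₂') (ha₃ : a₃ ≤ a₃') (hne0 : 0 ≤ ne) (hne : ne ≤ ne')
    (ht0 : 0 ≤ t) (ht : t ≤ t') :
    c₀n * (1 * (C₃ * c / Λ ^ 4 * (t + 6 * (K₂ * ne ^ 2)) ^ 3 + 3 * (C₂ * c / Λ ^ 3 * (t + 6 * (K₂ * ne ^ 2)) * (K₂ * ne ^ 2)) +
          C₁ * c / Λ ^ 2 * (K₃ * ne ^ 3)) +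
        3 * (a₁ * (C₂ * c / Λ ^ 3 * (t + s₅ * (K₂ * ne ^ 2)) ^ 2 + C₁ * c / Λ ^ 2 * (K₂ * ne ^ 2))) +
        3 * (a₂ * (C₁ * c / Λ ^ 2 * (t + s₄ * (K₂ * ne ^ 2)))) + a₃ * (4 * c / Λ)) ≤
      c₀n * (1 * (C₃ * c / Λ ^ 4 * (t' + 6 * (K₂ * ne' ^ 2)) ^ 3 + 3 * (C₂ * c / Λ ^ 3 * (t' + 6 * (K₂ * ne' ^ 2)) * (K₂ * ne' ^ 2)) +
          C₁ * c / Λ ^ 2 * (K₃ * ne' ^ 3)) +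
        3 * (a₁' * (C₂ * c / Λ ^ 3 * (t' + s₅ * (K₂ * ne' ^ 2)) ^ 2 + C₁ * c / Λ ^ 2 * (K₂ * ne' ^ 2))) +
        3 * (a₂' * (C₁ * c / Λ ^ 2 * (t' + s₄ * (K₂ * ne' ^ 2)))) + a₃' * (4 * c / Λ)) := by
  have hne2 : ne ^ 2 ≤ ne' ^ 2 := pow_le_pow_left₀ hne0 hne 2
  have hne3 : ne ^ 3 ≤ ne' ^ 3 := pow_le_pow_left₀ hne0 hne 3
  have hK2 : K₂ * ne ^ 2 ≤ K₂ * ne' ^ 2 := mul_le_mul_of_nonneg_left hne2 hK₂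
  have hK30 : 0 ≤ K₃ * ne ^ 3 := by positivity
  have hK3 : K₃ * ne ^ 3 ≤ K₃ * ne' ^ 3 := mul_le_mul_of_nonneg_left hne3 hK₃
  have h6 : t + 6 * (K₂ * ne ^ 2) ≤ t' + 6 * (K₂ * ne' ^ 2) := by linarith
  have h60 : 0 ≤ t + 6 * (K₂ * ne ^ 2) := by positivity
  have h5 : t + s₅ * (K₂ * ne ^ 2) ≤ t' + s₅ * (K₂ * ne' ^ 2) := by have := mul_le_mul_of_nonneg_left hK2 hs₅; linarith
  have h50 : 0 ≤ t + s₅ * (K₂ * ne ^ 2) := by positivity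
  have h4 : t + s₄ * (K₂ * ne ^ 2) ≤ t' + s₄ * (K₂ * ne' ^ 2) := by have := mul_le_mul_of_nonneg_left hK2 hs₄; linarith
  have h40 : 0 ≤ t + s₄ * (K₂ * ne ^ 2) := by positivity
  have hK20 : 0 ≤ K₂ * ne ^ 2 := by positivity
  have ha₁0' : 0 ≤ a₁' := ha₁0.trans ha₁
  have ha₂0' : 0 ≤ a₂' := ha₂0.trans ha₂
  have h60' : 0 ≤ t' + 6 * (K₂ * ne' ^ 2) := h60.trans h6
  have hX' : 0 ≤ C₂ * c / Λ ^ 3 * (t' + 6 * (K₂ * ne' ^ 2)) := by positivity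
  gcongr

end Summit.HubbardSuperconductivity.HubbardSuperconductivity.Theorems.TorusFourierL2

end
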